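import Literature.AnabelianGeometry.SemiGraphs.TemperedAnabelian
import Literature.FieldTheory.Galois.FixingSubgroupAbsoluteGalois
import HarnessLib

/-!
# [SemiAnbd] §6: the Galois identification `G_K = Gal(K̄/K)` of a tempered curve

S. Mochizuki, *Semi-graphs of anabelioids*, Publ. RIMS 42 (2006), §6 p. 69: "Let `K` be a finite
extension of `ℚ_p`, and `K̄` an algebraic closure of `K`. Write `G_K := Gal(K̄/K)`."
[cite: MochizukiSemiAnbd2006, §6 p.69]

In the cell's §6 interface `TemperedCurve p` (`TemperedAnabelian.lean`, abc-iut-L3-t4) the base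
field is an intermediate field `X.K` of the FIXED algebraic closure `K̄ := AlgebraicClosure ℚ_[p]`
and `X.GK := X.K.fixingSubgroup ≤ G_{ℚ_p}` (subspace Krull topology), whereas the group-level
interfaces of [SemiAnbd] §3–§5 / [EtTh] §1 (abc-iut-L3-t2, `TemperedArithmeticGroup K`) are typed
over Mathlib's `Field.absoluteGaloisGroup K = Gal(AlgebraicClosure K / K)`. RULING η (L3-lead,
2026-08-25) makes the bridge `TemperedCurve.toTemperedArithmeticGroup` take the identification
`ι : X.GK ≃ₜ* Field.absoluteGaloisGroup X.K` as a PARAMETER; this file CONSTRUCTS it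
(`TemperedCurve.galoisIdentification`, item G11 of plan/L3/DISCHARGE-L3.md) as the specialisation
`F := ℚ_[p]`, `L := AlgebraicClosure ℚ_[p]` of the general
`Literature.FieldTheory.Galois.fixingSubgroupEquivAbsoluteGaloisGroup` (continuity both ways proved
there; canonical up to an inner automorphism = the choice of `K`-isomorphism
`AlgebraicClosure ℚ_[p] ≃ₐ[K] AlgebraicClosure K`). No finiteness of `K/ℚ_p` is used.
-/

noncomputable section

namespace Literature.AnabelianGeometry.SemiGraphs

namespace TemperedCurve

variable {p : ℕ} [Fact p.Prime]

/-- **The Galois identification `ι : G_K ≃ₜ* Gal(K̄_K/K)`** of a tempered curve `X` over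
`K ⊆ K̄ = AlgebraicClosure ℚ_[p]`: the closed subgroup `X.GK = Gal(K̄/K)` of `G_{ℚ_p}` (subspace
Krull topology) is topologically isomorphic to Mathlib's absolute Galois group of the field `K`
([SemiAnbd] §6 p. 69 "`G_K := Gal(K̄/K)`"; the parameter `ι` of RULING η's
`TemperedCurve.toTemperedArithmeticGroup`). [cite: MochizukiSemiAnbd2006, §6 p.69] -/
def galoisIdentification (X : TemperedCurve p) : X.GK ≃ₜ* Field.absoluteGaloisGroup X.K :=
  Literature.FieldTheory.Galois.fixingSubgroupEquivAbsoluteGaloisGroup X.K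

/-- Existence form: the parameter type `X.GK ≃ₜ* Field.absoluteGaloisGroup X.K` of the tempered
curve / tempered-arithmetic-group bridge is inhabited. [cite: MochizukiSemiAnbd2006, §6 p.69] -/
theorem nonempty_galoisIdentification (X : TemperedCurve p) :
    Nonempty (X.GK ≃ₜ* Field.absoluteGaloisGroup X.K) :=
  ⟨X.galoisIdentification⟩

/-- The underlying automorphism of `K̄ = AlgebraicClosure ℚ_[p]` of `ι⁻¹ τ`, for `τ ∈ Gal(K̄_K/K)`,
is `e⁻¹ ∘ τ ∘ e` for the chosen `K`-isomorphism `e : K̄ ≃ₐ[K] K̄_K`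
(`Literature.FieldTheory.Galois.algEquivAlgebraicClosure X.K`). [cite: MochizukiSemiAnbd2006, §6 p.69] -/
theorem galoisIdentification_symm_apply (X : TemperedCurve p)
    (τ : AlgebraicClosure X.K ≃ₐ[X.K] AlgebraicClosure X.K) (x : AlgebraicClosure ℚ_[p]) :
    ((X.galoisIdentification.symm τ : X.GK) : GQp p) x =
      (Literature.FieldTheory.Galois.algEquivAlgebraicClosure X.K).symm
        (τ (Literature.FieldTheory.Galois.algEquivAlgebraicClosure X.K x)) :=
  rfl

end TemperedCurve

end Literature.AnabelianGeometry.SemiGraphs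

end
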